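import Summits.QuantumFields.QCD.Theorems.QuarksAsStableActionStableActionBridgeAPDetTransferForm
import Summits.QuantumFields.QCD.Theorems.QuarksAsStableActionStableActionBridgeAPChainBlockPos
import Summits.QuantumFields.QCD.Theorems.QuarksAsStableActionStableActionBridgeAPTraceFreePos

/-!
# The free all-antiperiodic Wilson fermion determinant is strictly positive for every `m > −1`
(crux `QuarksAsStableAction.StableActionBridge`, item stmt-QuantumFields-9737, line `Sketch`; lead capstone of
continuation lead c3, cycle 4, `--supports stmt-QuantumFields-9737`; registered sub-goal `apDet_free_pos`)

For every `N`, every `L ≥ 1` and every bare mass `m > −1` (hopping parameter `κ < 1/6`), the route's free antiperiodic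
Wilson determinant `apDet 1 m = fermionDet (wilsonDiracAP 1 m)` (all four directions antiperiodic, `r = 1`, colour
`SU(N)`) is a STRICTLY POSITIVE REAL number.  This is the `U = 1` case of Lüscher's transfer-matrix formula landed this
cycle: `apDet U m = (∏_t det E_t) · det(1 + ∏_t M_t Ŵ_t)` (`apDet_transfer_form`, p121274) with the prefactor a positive
real (`prod_det_apChainBlock_pos`, p121685: `det E_t = det(w′_{t−1})² det(B_t)²`, `det(w′)² = 1`, `B_t > 0`) and, for
the free field, the trace factor `det(1 + M^L) > 0` (`apTrace_free_pos`, p121680: trivial transporters, identical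
slices, `M > 0`).  It removes the mass window `m ∈ [−1/2, 1]` from the non-vanishing of `‖apDet 1 m‖` used by the S-path
lemmas of this line (`free_patch_defect_bound`, p114014/p118297) and is the free-field instance of Lüscher's
positivity `Z = Tr 𝕋^L > 0`.  [cite: Luscher1977, pp. 283–292] [cite: MontvayMunster1994, §4.2.3 (4.111)]
-/

namespace Summit.QuantumFields.QCD.Cruxes.StableActionBridge.Sketch

open scoped ComplexOrder
open Literature.MathematicalPhysics.QuantumFieldTheory Literature.MathematicalPhysics.QuantumLattice

namespace APDetFreePos

/-- The product of two complex numbers that are positive reals is a positive real. -/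
theorem mul_pos_real {z w : ℂ} (hz : 0 < z.re) (hz' : z.im = 0) (hw : 0 < w.re) (hw' : w.im = 0) :
    0 < (z * w).re ∧ (z * w).im = 0 := by
  rw [Complex.mul_re, Complex.mul_im, hz', hw', mul_zero, sub_zero, mul_zero, zero_mul, add_zero]
  exact ⟨mul_pos hz hw, rfl⟩

end APDetFreePos

/-- **Positivity of the free all-antiperiodic Wilson determinant** (registered sub-goal `apDet_free_pos` of crux
stmt-QuantumFields-9737): for every `N`, `L ≥ 1` and `m > −1`,
`0 < Re (fermionDet (wilsonDiracAP 1 m))` and `Im (fermionDet (wilsonDiracAP 1 m)) = 0`.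
[cite: Luscher1977, pp. 283–292] [cite: MontvayMunster1994, §4.2.3 (4.111)] -/
theorem apDet_free_pos :
    ∀ (N L : ℕ) [NeZero L] (m : ℝ), -1 < m →
      0 < (fermionDet (wilsonDiracAP (1 : GaugeConfig 4 L (Matrix.specialUnitaryGroup (Fin N) ℂ)) m)).re ∧
        (fermionDet (wilsonDiracAP (1 : GaugeConfig 4 L (Matrix.specialUnitaryGroup (Fin N) ℂ)) m)).im = 0 := by
  intro N L _ m hm
  have h := (apDet_transfer_form N L 1 m hm).1
  have hP := prod_det_apChainBlock_pos N L 1 m hm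
  have hT := apTrace_free_pos N L m hm
  rw [h]
  exact APDetFreePos.mul_pos_real hP.1 hP.2 hT.1 hT.2

/-- The free all-antiperiodic Wilson determinant does not vanish for `m > −1`. -/
theorem apDet_free_ne_zero (N L : ℕ) [NeZero L] {m : ℝ} (hm : -1 < m) :
    fermionDet (wilsonDiracAP (1 : GaugeConfig 4 L (Matrix.specialUnitaryGroup (Fin N) ℂ)) m) ≠ 0 := fun h => by
  have h1 := (apDet_free_pos N L m hm).1
  rw [h, Complex.zero_re] at h1
  exact lt_irrefl 0 h1

/-- The free all-antiperiodic Wilson determinant has strictly positive norm for `m > −1` (the denominator of the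
S-path's free-patch defect bounds). -/
theorem norm_apDet_free_pos (N L : ℕ) [NeZero L] {m : ℝ} (hm : -1 < m) :
    0 < ‖fermionDet (wilsonDiracAP (1 : GaugeConfig 4 L (Matrix.specialUnitaryGroup (Fin N) ℂ)) m)‖ :=
  norm_pos_iff.mpr (apDet_free_ne_zero N L hm)

end Summit.QuantumFields.QCD.Cruxes.StableActionBridge.Sketch
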